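import Summits.PneNP.PneNP.Theses.KarlinRubin
import Literature.Computability.Complexity.CircuitClassesProofs
import Literature.Computability.Complexity.PseudoComplementCircuits
import Summits.PneNP.PneNP.Theorems.KarlinRubinMonotoneSufficesNegatedInputs

/-!
# Crux `MonotoneSuffices` (stmt-PneNP-18026), line `Sketch` — rung 1½: negations of JUNTAS are
eliminable at size cost `2^m`

Generalising the first rung (`stub_negatedInputs`: negated input VARIABLES): let a detector be a
`{∧₂,∨₂,0,1}`-circuit `D` on the edge variables plus a block `κ` of extra wires, the wire `j ∈ κ`
carrying `¬g_j(x)` for ARBITRARY Boolean functions `g_j` that jointly depend only on a set `S` of `m`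
edge coordinates (negation gates applied to juntas — no circuit for the `g_j` is needed). Compressing
`f(x) = D(x, (¬g_j(x))_j)` along `e ∈ S` is computed EXACTLY by a `{∧₂,∨₂,0,1}`-circuit of size
`≤ 2|D| + 6` on the edge variables plus the doubled block `κ × Bool`, read at the negated RESTRICTIONS
`¬g_j(x[e←b])` (`junta_step`), which depend only on `S ∖ e`. After all of `S` the restrictions are
constants, so the fully compressed test is a `{∧₂,∨₂,0,1}`-circuit of size `≤ 2^m(|D|+6)+2` on the edge
variables alone, with error sum no larger on the planted pair (`junta_elim`, by the landed stubs
`stub_nullMass` / `stub_plantedMass`). In the crux's format (`stub_juntaNegations`): detector families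
with `2^{|S n|} ≤ (s n + n)^c` are monotonised with exponent `a = c + 1`. Rung 1 is the case
`κ = S`, `g_j(x) = x_j`.
-/

set_option linter.dupNamespace false -- `Summit.PneNP.PneNP.…`: summit = sub-problem name (D-0017)

namespace Summit.PneNP.PneNP.Theorems.MonotoneSuffices.Compression

open Literature.Computability.Complexity Literature.Probability.RandomGraphs.PlantedClique Filter Finset
open Function (update)
open scoped ENNReal

/-! ### One compression step (generic inputs `ι`, generic wire block `κ`) -/

section Step

variable {ι : Type*} [DecidableEq ι] {κ : Type*}

/-- The restriction map `ρ_b : z ↦ (z_inl[e := b], (z_{(j,b)})_j)` from the doubled block to the simple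
block costs one constant gate over `{∧₂,∨₂,0,1}`. [folklore] -/
theorem junta_cktSize_restrict (e : ι) (b : Bool) :
    CktSize monotoneBasis01 (fun (z : ι ⊕ (κ × Bool) → Bool) (w : ι ⊕ κ) =>
      Sum.elim (update (fun i => z (Sum.inl i)) e b) (fun j => z (Sum.inr (j, b))) w) 1 := by
  have h : CktSize monotoneBasis01 (fun (z : ι ⊕ (κ × Bool) → Bool) =>
      Sum.elim z (fun (_ : Unit) => b)) (0 + 1) :=
    (CktSize.id monotoneBasis01).pair (cktSize_const_mono01 _ b)
  refine (h.outMap (Sum.elim (fun i => if i = e then Sum.inr () else Sum.inl (Sum.inl i))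
    (fun j => Sum.inl (Sum.inr (j, b))))).congr fun z w => ?_
  rcases w with i | j
  · by_cases hi : i = e
    · subst hi
      rw [Sum.elim_inl, if_pos rfl, Sum.elim_inr, Sum.elim_inl, Function.update_self]
    · rw [Sum.elim_inl, if_neg hi, Sum.elim_inl, Sum.elim_inl, Function.update_of_ne hi]
  · rfl

/-- **One step.** Compressing `x ↦ D(x, (¬g_j(x))_j)` along `e` is computed EXACTLY by a
`{∧₂,∨₂,0,1}`-circuit of size `≤ 2s + 6` on the doubled block, read at the negated restrictions
`¬g_j(x[e←b])`. [folklore] -/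
theorem junta_step (e : ι) (F : (ι ⊕ κ → Bool) → Bool) (g : κ → (ι → Bool) → Bool) (s : ℕ)
    (hF : CktSize monotoneBasis01 (fun z (_ : Unit) => F z) s) :
    ∃ F' : (ι ⊕ (κ × Bool) → Bool) → Bool,
      CktSize monotoneBasis01 (fun z (_ : Unit) => F' z) (2 * s + 6) ∧
      ∀ x : ι → Bool,
        ((F (Sum.elim (update x e false) (fun j => !(g j (update x e false)))) &&
            F (Sum.elim (update x e true) (fun j => !(g j (update x e true))))) ||
          (x e &&
            (F (Sum.elim (update x e false) (fun j => !(g j (update x e false)))) ||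
              F (Sum.elim (update x e true) (fun j => !(g j (update x e true))))))) =
        F' (Sum.elim x (fun jb : κ × Bool => !(g jb.1 (update x e jb.2)))) := by
  -- the two restricted copies of `F`
  have hc : ∀ b : Bool, CktSize monotoneBasis01 (fun (z : ι ⊕ (κ × Bool) → Bool) (_ : Unit) =>
      F (Sum.elim (update (fun i => z (Sum.inl i)) e b) (fun j => z (Sum.inr (j, b))))) (1 + s) :=
    fun b => ((junta_cktSize_restrict e b).comp hF).congr fun _ _ => rfl
  -- bundle them with the pass-through of the inputs, then sort
  have hG : CktSize monotoneBasis01 (fun (z : ι ⊕ (κ × Bool) → Bool) =>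
      Sum.elim (Sum.elim
        (fun (_ : Unit) => F (Sum.elim (update (fun i => z (Sum.inl i)) e false) (fun j => z (Sum.inr (j, false)))))
        (fun (_ : Unit) => F (Sum.elim (update (fun i => z (Sum.inl i)) e true) (fun j => z (Sum.inr (j, true)))))) z)
      (((1 + s) + (1 + s)) + 0) := ((hc false).pair (hc true)).pair (CktSize.id monotoneBasis01)
  have hS := hG.comp (negIn_cktSize_sort (ι := (Unit ⊕ Unit) ⊕ (ι ⊕ (κ × Bool)))
    (Sum.inl (Sum.inl ())) (Sum.inl (Sum.inr ())) (Sum.inr (Sum.inl e)))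
  refine ⟨fun z =>
      ((F (Sum.elim (update (fun i => z (Sum.inl i)) e false) (fun j => z (Sum.inr (j, false)))) &&
          F (Sum.elim (update (fun i => z (Sum.inl i)) e true) (fun j => z (Sum.inr (j, true))))) ||
        (z (Sum.inl e) &&
          (F (Sum.elim (update (fun i => z (Sum.inl i)) e false) (fun j => z (Sum.inr (j, false)))) ||
            F (Sum.elim (update (fun i => z (Sum.inl i)) e true) (fun j => z (Sum.inr (j, true))))))),
    (hS.of_le (by omega)).congr fun z _ => by simp only [Sum.elim_inl, Sum.elim_inr], fun x => ?_⟩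
  rfl

/-- Restricting a function that depends only on `S` at the coordinate `e` leaves a function that
depends only on `S ∖ e`. [folklore] -/
theorem junta_dependsOn_erase (S : Finset ι) (e : ι) (h : (ι → Bool) → Bool)
    (hh : ∀ (x : ι → Bool) (i : ι), i ∉ S → ∀ b : Bool, h (update x i b) = h x) (c : Bool) :
    ∀ (x : ι → Bool) (i : ι), i ∉ S.erase e → ∀ b : Bool,
      h (update (update x i b) e c) = h (update x e c) := by
  intro x i hi b
  by_cases hie : i = e
  · subst hie
    rw [Function.update_idem]
  · have hiS : i ∉ S := fun h' => hi (Finset.mem_erase.2 ⟨hie, h'⟩)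
    rw [Function.update_comm hie, hh _ i hiS]

/-- A function on a finite cube that depends on no coordinate is constant. [folklore] -/
theorem junta_const_of_dependsOn_empty [Fintype ι] (h : (ι → Bool) → Bool)
    (hh : ∀ (x : ι → Bool) (i : ι) (b : Bool), h (update x i b) = h x) (x y : ι → Bool) : h x = h y := by
  suffices key : ∀ (D : Finset ι) (x y : ι → Bool), (∀ i, i ∉ D → x i = y i) → h x = h y from
    key univ x y fun i hi => absurd (mem_univ i) hi
  intro D
  induction D using Finset.induction_on with
  | empty =>
    intro x y hxy
    have : x = y := funext fun i => hxy i (Finset.notMem_empty i)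
    rw [this]
  | insert i D hiD ih =>
    intro x y hxy
    have h1 : h (update x i (y i)) = h x := hh x i (y i)
    rw [← h1]
    refine ih _ _ fun i' hi' => ?_
    by_cases h' : i' = i
    · subst h'; rw [Function.update_self]
    · rw [Function.update_of_ne h']
      exact hxy i' fun hmem => by
        rcases Finset.mem_insert.1 hmem with h'' | h''
        · exact h' h''
        · exact hi' h''

end Step

/-! ### Iterating over the junta's support on the planted pair -/

/-- **Elimination of negated juntas on the planted pair.** For every finite set `S` of edge
coordinates, every `{∧₂,∨₂,0,1}`-circuit `F` (size `≤ s`) on the edge variables plus a block `κ` of extra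
wires, and every family `g : κ → (EdgeVec n → Bool)` of functions depending only on `S`, there is a
Boolean function `G` with a `{∧₂,∨₂,0,1}`-circuit of size `≤ 2^{|S|}(s+6) + 2` on the edge variables alone
whose error sum (type I under `G(n,1/2)` + type II under the planted `k`-clique) is at most that of the
detector `x ↦ F(x, (¬g_j(x))_j)` — by compressing along `S` (`junta_step`), the error sum never
increasing (`stub_nullMass`, `stub_plantedMass`), until every `g_j` is frozen to a constant. [folklore] -/
theorem junta_elim (n k : ℕ) (S : Finset ((⊤ : SimpleGraph (Fin n)).edgeSet)) :
    ∀ (κ : Type) (F : ((⊤ : SimpleGraph (Fin n)).edgeSet ⊕ κ → Bool) → Bool)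
      (g : κ → EdgeVec n → Bool) (s : ℕ),
      CktSize monotoneBasis01 (fun z (_ : Unit) => F z) s →
      (∀ (j : κ) (x : EdgeVec n) (i : (⊤ : SimpleGraph (Fin n)).edgeSet), i ∉ S →
        ∀ b : Bool, g j (update x i b) = g j x) →
      ∃ G : EdgeVec n → Bool,
        CktSize monotoneBasis01 (fun x (_ : Unit) => G x) (2 ^ S.card * (s + 6) + 2) ∧
        (erdosRenyiHalf n).toOuterMeasure {x | G x = true} +
            (plantedCliqueDist n k).toOuterMeasure {x | G x = false} ≤
          (erdosRenyiHalf n).toOuterMeasure {x | F (Sum.elim x (fun j => !(g j x))) = true} +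
            (plantedCliqueDist n k).toOuterMeasure {x | F (Sum.elim x (fun j => !(g j x))) = false} := by
  classical
  induction S using Finset.induction_on with
  | empty =>
    intro κ F g s hF hdep
    -- every `g j` is constant
    have hconst : ∀ (j : κ) (x : EdgeVec n), g j x = g j (fun _ => false) := fun j x =>
      junta_const_of_dependsOn_empty (g j) (fun x i b => hdep j x i (Finset.notMem_empty i) b) x _
    refine ⟨fun x => F (Sum.elim x (fun j => !(g j (fun _ => false)))), ?_, le_of_eq ?_⟩
    · -- the input map `x ↦ (x, (¬c_j)_j)` costs the two constant gates
      have h1 : CktSize monotoneBasis01 (fun (x : EdgeVec n) =>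
          Sum.elim (Sum.elim x (fun (_ : Unit) => true)) (fun (_ : Unit) => false)) ((0 + 1) + 1) :=
        ((CktSize.id monotoneBasis01).pair (cktSize_const_mono01 _ true)).pair (cktSize_const_mono01 _ false)
      have h2 : CktSize monotoneBasis01 (fun (x : EdgeVec n) (w : (⊤ : SimpleGraph (Fin n)).edgeSet ⊕ κ) =>
          Sum.elim x (fun j => !(g j (fun _ => false))) w) 2 := by
        refine (h1.outMap (Sum.elim (fun i => Sum.inl (Sum.inl i))
          (fun j => if g j (fun _ => false) then Sum.inr () else Sum.inl (Sum.inr ())))).congr fun x w => ?_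
        rcases w with i | j
        · rfl
        · simp only [Sum.elim_inr]
          cases g j (fun _ => false) <;> rfl
      exact ((h2.comp hF).of_le (by simp only [Finset.card_empty, pow_zero, one_mul]; omega)).congr
        fun _ _ => rfl
    · have hfun : ∀ x : EdgeVec n, F (Sum.elim x (fun j => !(g j x))) =
          F (Sum.elim x (fun j => !(g j (fun _ => false)))) := fun x => by
        have : (fun j => !(g j x)) = fun j => !(g j (fun _ => false)) := funext fun j => by rw [hconst j x]
        rw [this]
      have e1 : {x : EdgeVec n | F (Sum.elim x (fun j => !(g j x))) = true} =
          {x | F (Sum.elim x (fun j => !(g j (fun _ => false)))) = true} :=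
        Set.ext fun x => by rw [Set.mem_setOf_eq, Set.mem_setOf_eq, hfun x]
      have e2 : {x : EdgeVec n | F (Sum.elim x (fun j => !(g j x))) = false} =
          {x | F (Sum.elim x (fun j => !(g j (fun _ => false)))) = false} :=
        Set.ext fun x => by rw [Set.mem_setOf_eq, Set.mem_setOf_eq, hfun x]
      show (erdosRenyiHalf n).toOuterMeasure {x | F (Sum.elim x (fun j => !(g j (fun _ => false)))) = true} +
          (plantedCliqueDist n k).toOuterMeasure {x | F (Sum.elim x (fun j => !(g j (fun _ => false)))) = false} = _
      rw [e1, e2]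
  | insert e S heS ih =>
    intro κ F g s hF hdep
    obtain ⟨F', hF', hstep⟩ := junta_step e F g s hF
    -- the restrictions depend only on `S`
    have hdep' : ∀ (jb : κ × Bool) (x : EdgeVec n) (i : (⊤ : SimpleGraph (Fin n)).edgeSet), i ∉ S →
        ∀ b : Bool, g jb.1 (update (update x i b) e jb.2) = g jb.1 (update x e jb.2) := by
      intro jb x i hi b
      have := junta_dependsOn_erase (insert e S) e (g jb.1) (hdep jb.1) jb.2 x i
        (by rwa [Finset.erase_insert heS]) b
      exact this
    obtain ⟨G, hG, herr⟩ := ih (κ × Bool) F' (fun jb x => g jb.1 (update x e jb.2)) (2 * s + 6) hF' hdep'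
    refine ⟨G, ?_, herr.trans ?_⟩
    · rw [Finset.card_insert_of_notMem heS, pow_succ]
      exact hG.of_le (le_of_eq (by ring))
    · -- `F' ∘ (restrictions) = S_e (F ∘ ℓ)`, and compression does not increase the error sum
      let f : EdgeVec n → Bool := fun y => F (Sum.elim y (fun j => !(g j y)))
      have key : ∀ x : EdgeVec n,
          ((f (update x e false) && f (update x e true)) ||
              (x e && (f (update x e false) || f (update x e true)))) =
            F' (Sum.elim x (fun jb : κ × Bool => !(g jb.1 (update x e jb.2)))) := fun x => hstep x
      have hset1 : {x : EdgeVec n | F' (Sum.elim x (fun jb : κ × Bool => !(g jb.1 (update x e jb.2)))) = true} =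
          {x | ((f (update x e false) && f (update x e true)) ||
              (x e && (f (update x e false) || f (update x e true)))) = true} :=
        Set.ext fun x => by simp only [Set.mem_setOf_eq, key x]
      have hset2 : {x : EdgeVec n | F' (Sum.elim x (fun jb : κ × Bool => !(g jb.1 (update x e jb.2)))) = false} =
          {x | ((f (update x e false) && f (update x e true)) ||
              (x e && (f (update x e false) || f (update x e true)))) = false} :=
        Set.ext fun x => by simp only [Set.mem_setOf_eq, key x]
      rw [hset1, hset2]
      exact add_le_add (le_of_eq (stub_nullMass n e f)) (stub_plantedMass n k e f)

/-! ### The rung in the crux's format -/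

/-- **`MonotoneSuffices` for detectors whose negations sit on juntas.** Let a detector family be given
by `{∧₂,∨₂,0,1}`-circuits `D n` of size `≤ s n` on the edge variables plus a block `κ n` of wires
carrying `¬g_{n,j}(x)` for arbitrary functions `g_{n,j}` depending only on a set `S n` of edge
coordinates with `2^{|S n|} ≤ (s n + n)^c` eventually. If its error sum at clique size `k n` tends to `0`,
then `{∧₂,∨₂,0,1}`-circuits on the edge variables alone, of size `≤ (s n + n)^{c+1}` eventually, have
error sum `→ 0` (pointwise no larger). [folklore] -/
theorem stub_juntaNegations :
    ∀ (k s : ℕ → ℕ) (c : ℕ) (κ : ℕ → Type) (S : (n : ℕ) → Finset ((⊤ : SimpleGraph (Fin n)).edgeSet))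
      (D : (n : ℕ) → Circuit ((⊤ : SimpleGraph (Fin n)).edgeSet ⊕ κ n))
      (g : (n : ℕ) → κ n → EdgeVec n → Bool),
      (∀ᶠ n : ℕ in atTop, (D n).IsOver monotoneBasis01 ∧ (D n).size ≤ s n ∧
        2 ^ (S n).card ≤ (s n + n) ^ c ∧
        ∀ (j : κ n) (x : EdgeVec n) (i : (⊤ : SimpleGraph (Fin n)).edgeSet), i ∉ S n →
          ∀ b : Bool, g n j (update x i b) = g n j x) →
      Tendsto (fun n : ℕ =>
          (erdosRenyiHalf n).toOuterMeasure {x | (D n).eval (Sum.elim x (fun j => !(g n j x))) = true} +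
            (plantedCliqueDist n (k n)).toOuterMeasure
              {x | (D n).eval (Sum.elim x (fun j => !(g n j x))) = false})
        atTop (nhds 0) →
      ∃ M : (n : ℕ) → Circuit ((⊤ : SimpleGraph (Fin n)).edgeSet),
        (∀ᶠ n : ℕ in atTop, (M n).IsOver monotoneBasis01 ∧ (M n).size ≤ (s n + n) ^ (c + 1)) ∧
        Tendsto (fun n : ℕ => (erdosRenyiHalf n).toOuterMeasure {x | (M n).eval x = true} +
            (plantedCliqueDist n (k n)).toOuterMeasure {x | (M n).eval x = false}) atTop (nhds 0) := by
  intro k s c κ S D g hD herr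
  classical
  have hex : ∀ n : ℕ, (D n).IsOver monotoneBasis01 →
      (∀ (j : κ n) (x : EdgeVec n) (i : (⊤ : SimpleGraph (Fin n)).edgeSet), i ∉ S n →
        ∀ b : Bool, g n j (update x i b) = g n j x) →
      ∃ M : Circuit ((⊤ : SimpleGraph (Fin n)).edgeSet), M.IsOver monotoneBasis01 ∧
        M.size ≤ 2 ^ (S n).card * ((D n).size + 6) + 2 ∧
        (erdosRenyiHalf n).toOuterMeasure {x | M.eval x = true} +
            (plantedCliqueDist n (k n)).toOuterMeasure {x | M.eval x = false} ≤
          (erdosRenyiHalf n).toOuterMeasure {x | (D n).eval (Sum.elim x (fun j => !(g n j x))) = true} +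
            (plantedCliqueDist n (k n)).toOuterMeasure
              {x | (D n).eval (Sum.elim x (fun j => !(g n j x))) = false} := by
    intro n hDn hdep
    obtain ⟨G, hG, herrG⟩ :=
      junta_elim n (k n) (S n) (κ n) (D n).eval (g n) (D n).size ((D n).cktSize_eval hDn) hdep
    obtain ⟨M, hM, hsize, hev⟩ := hG.toCircuit
    refine ⟨M, hM, hsize, ?_⟩
    have h1 : {x | M.eval x = true} = {x | G x = true} := by ext x; simp [hev x]
    have h2 : {x | M.eval x = false} = {x | G x = false} := by ext x; simp [hev x]
    rw [h1, h2]
    exact herrG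
  let M : (n : ℕ) → Circuit ((⊤ : SimpleGraph (Fin n)).edgeSet) := fun n =>
    if h : (D n).IsOver monotoneBasis01 ∧
        ∀ (j : κ n) (x : EdgeVec n) (i : (⊤ : SimpleGraph (Fin n)).edgeSet), i ∉ S n →
          ∀ b : Bool, g n j (update x i b) = g n j x
      then (hex n h.1 h.2).choose else Circuit.const _ false
  have hMspec : ∀ᶠ n : ℕ in atTop, (M n).IsOver monotoneBasis01 ∧ (M n).size ≤ (s n + n) ^ (c + 1) ∧
      (erdosRenyiHalf n).toOuterMeasure {x | (M n).eval x = true} +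
          (plantedCliqueDist n (k n)).toOuterMeasure {x | (M n).eval x = false} ≤
        (erdosRenyiHalf n).toOuterMeasure {x | (D n).eval (Sum.elim x (fun j => !(g n j x))) = true} +
          (plantedCliqueDist n (k n)).toOuterMeasure
            {x | (D n).eval (Sum.elim x (fun j => !(g n j x))) = false} := by
    filter_upwards [hD, eventually_ge_atTop 8] with n hn h8
    have hP : (D n).IsOver monotoneBasis01 ∧
        ∀ (j : κ n) (x : EdgeVec n) (i : (⊤ : SimpleGraph (Fin n)).edgeSet), i ∉ S n →
          ∀ b : Bool, g n j (update x i b) = g n j x := ⟨hn.1, hn.2.2.2⟩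
    have hMn : M n = (hex n hP.1 hP.2).choose := dif_pos hP
    obtain ⟨hB, hsize, herrn⟩ := (hex n hP.1 hP.2).choose_spec
    rw [hMn]
    refine ⟨hB, hsize.trans ?_, herrn⟩
    have hq : 1 ≤ (s n + n) ^ c := Nat.one_le_pow _ _ (by omega)
    calc 2 ^ (S n).card * ((D n).size + 6) + 2
        ≤ (s n + n) ^ c * (s n + 6) + 2 * (s n + n) ^ c :=
          Nat.add_le_add (Nat.mul_le_mul hn.2.2.1 (by omega)) (by omega)
      _ = (s n + n) ^ c * (s n + 8) := by ring
      _ ≤ (s n + n) ^ c * (s n + n) := Nat.mul_le_mul_left _ (by omega)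
      _ = (s n + n) ^ (c + 1) := (pow_succ _ _).symm
  refine ⟨M, hMspec.mono fun n h => ⟨h.1, h.2.1⟩, ?_⟩
  exact tendsto_of_tendsto_of_tendsto_of_le_of_le' tendsto_const_nhds herr
    (Eventually.of_forall fun _ => bot_le) (hMspec.mono fun n h => h.2.2)

end Summit.PneNP.PneNP.Theorems.MonotoneSuffices.Compression
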